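import Summits.BirchSwinnertonDyer.BirchSwinnertonDyer.Theorems.InertBadSignedBranchesInertBadAtThreeIstarZeroOfEtaMC
import HarnessLib

/-!
# Route `InertBadSignedBranches` (rung K8): the rung leaf `X12.CMInertBad` from the route's cruxes with
# the readings item `PrintReadingsInert` REPLACED by Kobayashi's even main conjecture at `η` for CM
# curves (ONE verbatim form, `p ≥ 5`) and two NAMED Literature facts (helper; cell `bsd-cm`, seat
# `bsd-cm-k8i-c41` gen 2; theorems only, nothing asserted)

HONEST FRAMING (cell `bsd-cm`, `run/shared/lean/pub/bsd-cm/`): Birch–Swinnerton-Dyer is NOT proved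
by any of this; the rung leaf K8 (`X12.CMInertBad`, the `p`-part of BSD for every rank-one CM curve
at an inert BAD prime) is OPEN; this file is a BRIDGE VARIANT, conditional on the route's open
cruxes (`CccOneLawOnTypeIstarZero`, `InertBadOffType`, `InertBadAtThree`), one conjecture-grade
reading (Kobayashi's even main conjecture at `η` for CM curves, Pollack–Rubin's p. 448 REMARK) and
named published facts. 0 definitions, 0 named facts minted, 0 `sorry`; nothing booked, no label
moves; the route file is NOT edited (D-0014: the planner decides).

PARTITION (D-0054): CornerF inert-bad (B12 / O10) × O10 (995 pairs at `p ≥ 5` + 154 at `p = 3`;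
leaf K8) × `p` inert — types-the-object-of; closes no cell.

## What is here and why

The route's landed bridge `CMRungInputs.cmInertBad_of_inputs` (p406906) takes the readings item
`PrintReadingsInert` (stmt-19226): conjunct 1 = (C1_η) for CM good-inert `V` in the `ℚ(√p*)`-subtower
form `Additive.QuadraticBranchPlusMainConjectureAt V p` (reading flag
`Kob03-MC-eta-quadratic-subtower`), conjunct 2 = (R2) + the exact Kobayashi-7.4 reading text with a
`QuadraticBranchPlusMainConjectureAt V p →` binder. The typer bsd-cm-k8i-ty found (C1_η)-for-CM is
NOT a printed theorem (19226 cannot close from print) and the planner deferred a split (D82 (b)).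
The seat's gen-2 files (p424110 `…EtaMCPair`, `…OfEtaMC`) show that the `ℚ(√p*)`-form is consumed
ONLY as the dummy argument of that binder, and re-run the O10-PS chain `h1`-free at every odd `p`.
THIS FILE composes them into the bridge shape:

  `cmInertBad_of_cccOne_of_kobayashi74_of_plusMCEtaK :
     CccOneLawOnTypeIstarZero → InertBadOffType → InertBadAtThree →
     (hC1K : ∀ p ≥ 5, Kobayashi's even MC at η for CM V, K_∞-form) →
     KitajimaOtsuki2018.mainThm13_… → Kobayashi2003.thm74_… → PublishedFactsInert → X12.CMInertBad`

i.e. the route's `Assembly` with `PrintReadingsInert` replaced by {ONE verbatim printed-conjecture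
statement, two named PUBLISHED facts}. For the planner's restatement window (D82): typing the
conjecture-grade conjunct α of 19226 in the `K_∞^η`-form ALONE suffices for the assembly; (R2) and
the exact reading need no item (they are fact-conditional theorems); the flag
`Kob03-MC-eta-quadratic-subtower` leaves the cone. The typed C-cc-1 law (`+ δ` form at `δ = 0`,
guard `5 ≤ p`) is read in the `δ`-free pair form by `add_zero` (NIT-K8P3-2).

References (locators only): [Kobayashi2003] §4 (p. 8), Thm. 7.4 (p. 13); [KitajimaOtsuki2018] Main
Thm. 1.3; [PollackRubin2004] Theorem and remark (p. 448); [Mazur1978] Cor. 4.1; [Miller2011LMS] §1,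
Def. 1.1; [LiLiuTian2024] Thm. 1.1 (i) (shape of the leaf).
-/

set_option autoImplicit false
set_option linter.dupNamespace false

noncomputable section

open scoped Classical NumberField
open CongruenceSubgroup Field Function NumberField IsDedekindDomain IsDedekindDomain.HeightOneSpectrum
  WeierstrassCurve Rat.HeightOneSpectrum
open Literature.NumberTheory.EllipticCurves
open Literature.NumberTheory.EllipticCurves.ModularForms
open Literature.NumberTheory.EllipticCurves.Rank1Residual
open Literature.NumberTheory.EllipticCurves.Rank1Residual.Typed
open Literature.NumberTheory.GaloisRepresentations
open Literature.NumberTheory.GaloisCohomology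
open ZpExtension
open Summit.BirchSwinnertonDyer.Rank1Residual
open Summit.BirchSwinnertonDyer.Rank1Residual.Additive
open Summit.BirchSwinnertonDyer.Rank1Residual.X12
open Summit.BirchSwinnertonDyer.Rank1Residual.X12.O10
open Summit.BirchSwinnertonDyer.BirchSwinnertonDyer.Theses.InertBadSignedBranches
open Summit.BirchSwinnertonDyer.BirchSwinnertonDyer.Theorems.InertBadOdd

namespace Summit.BirchSwinnertonDyer.BirchSwinnertonDyer.Theorems.InertBadOddEta

/-- **The typed C-cc-1 law READ in the `δ`-free pair form at `p ≥ 5`**: the route crux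
`CccOneLawOnTypeIstarZero` (`QuadraticBranchPAdicGrossZagierValuationAt W p` =
`QuadraticBranchMinusLeadingValuationAt W p 0`, guard `5 ≤ p` inside) gives, at every `p ≥ 5`, the
pair-form law on the type used by the `h1`-free chain (`+ 0` removed by `add_zero`, NIT-K8P3-2).
Unfolding only. [cite: Kobayashi2003, §3 (3.5)–(3.7) (p. 7)] [cite: Miller2011LMS, §1 and Def. 1.1] -/
theorem pairLaw_of_cccOneLawOnTypeIstarZero (h₁ : CccOneLawOnTypeIstarZero) (p : ℕ) [Fact p.Prime]
    (hp5 : 5 ≤ p) :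
    ∀ (W : WeierstrassCurve ℚ) [W.IsElliptic] [W.IsGloballyMinimal],
      HasSignedLocalType W p (.Istar 0) → W.analyticRank = 1 →
      ∀ (V : WeierstrassCurve ℚ) [V.IsElliptic] [V.IsGloballyMinimal] (C : VariableChange ℚ)
        {N : ℕ} [NeZero N] {f : CuspForm (Gamma0 N) 2},
        C • W.quadraticTwist ((-1) ^ (p / 2) * p) = V →
        V.HasGoodReductionAtPrime p → V.frobeniusTrace p = 0 → IsNewformOf V f →
        ∀ (ϖ : ℚ), (if Even (p / 2) then (ϖ : ℝ) * V.realPeriodRat = plusPeriod f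
            else (ϖ : ℝ) * V.imaginaryPeriodRat = minusPeriod f) →
        ∀ (L : IwasawaAlgebra p), IsQuadraticBranchMinusLFunction f p ϖ L →
        (∀ Q : (W.baseChange ℚ_[p]).toAffine.Point, p • Q = 0 → Q = 0) →
        ∀ (P : W.toAffine.Point) (n : ℕ), ¬ IsOfFinAddOrder P →
        (∀ R : W.toAffine.Point, ∃ (k : ℤ) (T : W.toAffine.Point), IsOfFinAddOrder T ∧ R = k • P + T) →
        (∃ Q : (W.baseChange ℚ_[p]).toAffine.Point, p ^ n • Q = W.toPadicPoint p P) →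
        (∀ Q : (W.baseChange ℚ_[p]).toAffine.Point, p ^ (n + 1) • Q ≠ W.toPadicPoint p P) →
        ∀ (q : ℚ), shaAn W = (q : ℂ) →
        PowerSeries.coeff 1 L ≠ 0 ∧
          ((PowerSeries.coeff 1 L : ℤ_[p]) : ℚ_[p]).valuation =
            2 * (n : ℤ) + padicValRat p (q * W.tamagawaProduct / (W.torsionOrder : ℚ) ^ 2) := by
  intro W _ _ hT hr V _ _ C N _ f hCV hgood hap hf ϖ hϖ L hL htors P n hP hgen hdiv hndiv q hq
  have h := h₁ p hp5 W hT hr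
  rw [quadraticBranchPAdicGrossZagierValuationAt_iff, quadraticBranchMinusLeadingValuationAt_iff] at h
  have h' := h V C hp5 hCV hgood hap hr hf ϖ hϖ L hL htors P n hP hgen hdiv hndiv q hq
  rwa [add_zero] at h'

/-- **THE RUNG LEAF K8 `X12.CMInertBad` FROM THE ROUTE'S CRUXES, with `PrintReadingsInert` REPLACED by
Kobayashi's even main conjecture at `η` for CM curves (ONE verbatim form) and two NAMED facts.**
Hypotheses: `h₁` = `CccOneLawOnTypeIstarZero` (crux, open), `h₂` = `InertBadOffType` (residual),
`h₃` = `InertBadAtThree` (residual; = its two D71 children by the landed glue), `hC1K` = for every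
`p ≥ 5`, every `K₀ ⊇ ℚ(μ_p)`-tower datum and every CM `V` good at `p` with `a_p(V) = 0`: VERBATIM
Kobayashi 2003 §4 p. 8 "`Char(X⁺(E/K_∞)^η) = (L_p⁺(E, η, X))`" (Pollack–Rubin's p. 448 REMARK for
CM; conjecture-grade by content — the ONE reading input not in print), `hKO` =
`KitajimaOtsuki2018.mainThm13_etaSignedSelmerDual_noFiniteSubmodule`, `h74` =
`Kobayashi2003.thm74_etaEvenMC_iff_etaOddMC` (named PUBLISHED facts), `h₆` = `PublishedFactsInert`
verbatim. Proof: the case split of `CMRungInputs.cmInertBad_of_inputs` (p406906) with the `p ≥ 5`,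
type-`I₀*` branch run through the `h1`-free node
`missingInputAt_IstarZero_of_pairLaw_of_kobayashi74_of_plusMCEtaK_of_ne_two` (law read `δ`-free by
`pairLaw_of_cccOneLawOnTypeIstarZero`; (R2), the exact reading, `hper`, `ord_p c_p = 0` by name /
proved inside). CONDITIONAL on every displayed hypothesis; closes nothing by itself; the route file
is untouched. [cite: Kobayashi2003, §4 (p. 8), Thm. 7.4 (p. 13)] [cite: KitajimaOtsuki2018, Main Thm. 1.3]
[cite: PollackRubin2004, p. 448 (remark)] [cite: Mazur1978, Cor. 4.1] [cite: Miller2011LMS, §1 and Def. 1.1] -/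
theorem cmInertBad_of_cccOne_of_kobayashi74_of_plusMCEtaK (h₁ : CccOneLawOnTypeIstarZero)
    (h₂ : InertBadOffType) (h₃ : InertBadAtThree)
    (hC1K : ∀ (p : ℕ) [Fact p.Prime], 5 ≤ p →
      ∀ (K₀ : Type) [Field K₀] [NumberField K₀] [IsCyclotomicExtension {p} ℚ K₀]
        [(galRange (K := ℚ) K₀).Normal] (ηχ : absoluteGaloisGroup ℚ →* ℤˣ),
        (∀ σ ∈ galRange (K := ℚ) K₀, ηχ σ = 1) → ηχ ≠ 1 →
      ∀ (V : WeierstrassCurve ℚ) [V.IsElliptic] [V.IsGloballyMinimal] {N : ℕ} [NeZero N]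
        {f : CuspForm (Gamma0 N) 2}, V.HasCM →
        p ≠ 2 → V.HasGoodReductionAtPrime p → V.frobeniusTrace p = 0 → IsNewformOf V f →
      ∀ (ϖ : ℚ), (if Even (p / 2) then (ϖ : ℝ) * V.realPeriodRat = plusPeriod f
          else (ϖ : ℝ) * V.imaginaryPeriodRat = minusPeriod f) →
      ∀ (κ : ZpExtension ℚ p) (γ : absoluteGaloisGroup ℚ),
        κ.IsCyclotomic → κ.IsTopGenerator γ → γ ∈ galRange (K := ℚ) K₀ → IsCyclotomicVariable p γ →
      ∀ (Lp : IwasawaAlgebra p), Additive.IsQuadraticBranchPlusLFunction f p ϖ Lp →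
      ∀ D : Additive.EtaSignedSelmerDualData V κ K₀ ℚ_[p] ηχ γ 1, D.charIdeal = Ideal.span {Lp})
    (hKO : KitajimaOtsuki2018.mainThm13_etaSignedSelmerDual_noFiniteSubmodule)
    (h74 : Kobayashi2003.thm74_etaEvenMC_iff_etaOddMC) (h₆ : PublishedFactsInert) :
    X12.CMInertBad := by
  -- the case split of CMRungInputs.cmInertBad_of_inputs (planner/bridge p406906), `I₀*` branch h1-free
  intro W _ _ p _ hCM hr hp2 hin hbad
  have hp : p.Prime := Fact.out
  by_cases h3 : p = 3
  · subst h3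
    exact h₃ W hCM hr hin hbad
  · have hp5 : 5 ≤ p := by
      by_contra hlt
      have hlt' : p < 5 := Nat.lt_of_not_le hlt
      interval_cases p
      · exact Nat.not_prime_zero hp
      · exact Nat.not_prime_one hp
      · exact hp2 rfl
      · exact h3 rfl
      · exact absurd hp (by decide)
    by_cases hT : HasSignedLocalType W p (.Istar 0)
    · obtain ⟨hmod, hGZ, hGZK, hPT, hnf, hM⟩ := h₆
      exact missingInputAt_IstarZero_of_pairLaw_of_kobayashi74_of_plusMCEtaK_of_ne_two p hmod hGZ hGZK hPT
        hnf hM hKO h74 (hC1K p hp5) (pairLaw_of_cccOneLawOnTypeIstarZero h₁ p hp5) hp2 W hT hr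
    · exact h₂ W p hCM hr hin hbad hp5 hT

/-- **The same, with the `p = 3` residual SPLIT into its D71 children** (the landed glue
`inertBadSignedBranches_inertBadAtThreeGlue_proof`'s shape: `InertBadAtThreeIstarZero →
InertBadAtThreeOffIstarZero → InertBadAtThree` by `by_cases`), so that the whole cone of the leaf
reads: C-cc-1 (`p ≥ 5`), the off-type residual, the two `p = 3` children, Kobayashi's even MC at `η`
for CM curves (`p ≥ 5`), two named facts, `PublishedFactsInert`. CONDITIONAL; closes nothing.
[cite: Kobayashi2003, §4 (p. 8), Thm. 7.4 (p. 13)] [cite: Miller2011LMS, §1 and Def. 1.1] -/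
theorem cmInertBad_of_cccOne_of_children_of_kobayashi74_of_plusMCEtaK (h₁ : CccOneLawOnTypeIstarZero)
    (h₂ : InertBadOffType) (h₃₁ : InertBadAtThreeIstarZero) (h₃₂ : InertBadAtThreeOffIstarZero)
    (hC1K : ∀ (p : ℕ) [Fact p.Prime], 5 ≤ p →
      ∀ (K₀ : Type) [Field K₀] [NumberField K₀] [IsCyclotomicExtension {p} ℚ K₀]
        [(galRange (K := ℚ) K₀).Normal] (ηχ : absoluteGaloisGroup ℚ →* ℤˣ),
        (∀ σ ∈ galRange (K := ℚ) K₀, ηχ σ = 1) → ηχ ≠ 1 →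
      ∀ (V : WeierstrassCurve ℚ) [V.IsElliptic] [V.IsGloballyMinimal] {N : ℕ} [NeZero N]
        {f : CuspForm (Gamma0 N) 2}, V.HasCM →
        p ≠ 2 → V.HasGoodReductionAtPrime p → V.frobeniusTrace p = 0 → IsNewformOf V f →
      ∀ (ϖ : ℚ), (if Even (p / 2) then (ϖ : ℝ) * V.realPeriodRat = plusPeriod f
          else (ϖ : ℝ) * V.imaginaryPeriodRat = minusPeriod f) →
      ∀ (κ : ZpExtension ℚ p) (γ : absoluteGaloisGroup ℚ),
        κ.IsCyclotomic → κ.IsTopGenerator γ → γ ∈ galRange (K := ℚ) K₀ → IsCyclotomicVariable p γ →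
      ∀ (Lp : IwasawaAlgebra p), Additive.IsQuadraticBranchPlusLFunction f p ϖ Lp →
      ∀ D : Additive.EtaSignedSelmerDualData V κ K₀ ℚ_[p] ηχ γ 1, D.charIdeal = Ideal.span {Lp})
    (hKO : KitajimaOtsuki2018.mainThm13_etaSignedSelmerDual_noFiniteSubmodule)
    (h74 : Kobayashi2003.thm74_etaEvenMC_iff_etaOddMC) (h₆ : PublishedFactsInert) :
    X12.CMInertBad := by
  refine cmInertBad_of_cccOne_of_kobayashi74_of_plusMCEtaK h₁ h₂ ?_ hC1K hKO h74 h₆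
  intro W _ _ _ hCM hr hin hbad
  by_cases hT : HasSignedLocalType W 3 (.Istar 0)
  · exact h₃₁ W hT hr
  · exact h₃₂ W hCM hr hin hbad hT

end Summit.BirchSwinnertonDyer.BirchSwinnertonDyer.Theorems.InertBadOddEta
end
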